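import Literature.Analysis.Calculus.CoordinateJets
import Literature.Analysis.PDE.WeakHarnackPointwise
import Literature.Analysis.PDE.ABPPointwise
import HarnessLib

/-!
# Evans–Krylov: jet-level vocabulary (top-slot directions, the symbol matrix, pure second
# derivatives, the size of the third derivatives)

Vocabulary shared by the files formalising Gilbarg–Trudinger's interior `C^{2,α}` estimate for
concave fully nonlinear equations (Thm. 17.14) in the coordinate-jet language of
`Literature/Analysis/Calculus/CoordinateJets.lean`: the equation is `F(y, θ, cjet₂ u(y)) = 0` for a
function `F` of `(y, θ, J) ∈ E × P × CJet ι 2`, `E = EuclideanSpace ℝ ι` with its standard basis.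

* `topJet Ω` — the `2`-jet supported in the top slot with entries `Ω : (Fin 2 → ι) → ℝ`
  (`Pi.single (Fin.last 2) Ω`); additive and homogeneous (`topJet_add`, `topJet_smul`,
  `topJet_sub`, `topJet_sum`);
* `symbolMatrix F x` — the symmetrised matrix `a_{ij} = ½(∂F/∂r_{ij} + ∂F/∂r_{ji})` of the
  derivative of `F` at the jet point `x` in the top slot (Gilbarg–Trudinger's `F_{ij}`); it is
  symmetric (`symbolMatrix_isSymm`), pairs with symmetric top-slot directions as the derivative
  (`fderiv_topJet_eq_pair`) and its quadratic form is the derivative in the rank-one direction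
  `ξ ⊗ ξ` (`dotProduct_symbolMatrix_mulVec`) — so (17.43) for `F` is the ellipticity of
  `symbolMatrix` in the sense of `KrylovSafonov.weakHarnack`;
* `quadHess u γ y = γᵀ (D²u(y))_{e} γ` — the pure second derivative `D_{γγ}u(y)` along a
  coordinate vector `γ : ι → ℝ` (`hessianMatrix` in the standard basis);
* `thirdSq u y = Σ_{I : Fin 3 → ι} (D³u(y)(e_I))²` — the squared size of the third derivatives;
* `hessianMatrix_eq_cjetOf` — the Hessian matrix entries are the top slot of `cjet₂ u`.

## References

* D. Gilbarg, N. S. Trudinger, *Elliptic Partial Differential Equations of Second Order* (2001),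
  §17.4, (17.43)–(17.46). [GilbargTrudinger2001]
-/

noncomputable section

open Matrix Finset

namespace Literature.Analysis.PDE.EvansKrylov

open Literature.Analysis.Calculus Literature.Analysis.PDE.ABP Literature.Analysis.PDE.KrylovSafonov

variable {ι : Type*} [Fintype ι] [DecidableEq ι]

/-! ### Top-slot jets -/

/-- The coordinate `2`-jet supported in the top (second-order) slot with entries `Ω`.
[folklore] -/
def topJet (Ω : (Fin 2 → ι) → ℝ) : CJet ι 2 := Pi.single (Fin.last 2) Ω

omit [Fintype ι] [DecidableEq ι] in
/-- The top slot of `topJet Ω` is `Ω`. [folklore] -/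
@[simp] theorem topJet_apply_last (Ω : (Fin 2 → ι) → ℝ) : topJet Ω (Fin.last 2) = Ω := by
  simp [topJet]

omit [Fintype ι] [DecidableEq ι] in
/-- The lower slots of `topJet Ω` vanish. [folklore] -/
theorem topJet_apply_of_ne (Ω : (Fin 2 → ι) → ℝ) {j : Fin 3} (hj : j ≠ Fin.last 2) :
    topJet Ω j = 0 := by
  unfold topJet
  exact Pi.single_eq_of_ne hj _

omit [Fintype ι] [DecidableEq ι] in
/-- `topJet` is additive. [folklore] -/
@[simp] theorem topJet_add (Ω Ω' : (Fin 2 → ι) → ℝ) : topJet (Ω + Ω') = topJet Ω + topJet Ω' := by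
  unfold topJet
  exact Pi.single_add _ _ _

omit [Fintype ι] [DecidableEq ι] in
/-- `topJet` is homogeneous. [folklore] -/
@[simp] theorem topJet_smul (c : ℝ) (Ω : (Fin 2 → ι) → ℝ) : topJet (c • Ω) = c • topJet Ω := by
  unfold topJet
  exact Pi.single_smul _ _ _

omit [Fintype ι] [DecidableEq ι] in
/-- `topJet` respects subtraction. [folklore] -/
@[simp] theorem topJet_sub (Ω Ω' : (Fin 2 → ι) → ℝ) : topJet (Ω - Ω') = topJet Ω - topJet Ω' := by
  unfold topJet
  exact Pi.single_sub _ _ _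

omit [Fintype ι] [DecidableEq ι] in
/-- `topJet 0 = 0`. [folklore] -/
@[simp] theorem topJet_zero : topJet (0 : (Fin 2 → ι) → ℝ) = 0 := by
  unfold topJet
  exact Pi.single_zero _

omit [Fintype ι] [DecidableEq ι] in
/-- `topJet` commutes with finite sums. [folklore] -/
theorem topJet_sum {κ : Type*} (s : Finset κ) (Ω : κ → (Fin 2 → ι) → ℝ) :
    topJet (∑ k ∈ s, Ω k) = ∑ k ∈ s, topJet (Ω k) := by
  classical
  induction s using Finset.induction_on with
  | empty => simp
  | insert k s hk ih => rw [Finset.sum_insert hk, Finset.sum_insert hk, topJet_add, ih]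

omit [DecidableEq ι] in
/-- Expansion of `Ω` in the elementary arrays: `Ω = Σ_{i,j} Ω(i,j) • δ_{(i,j)}`. [folklore] -/
theorem eq_sum_sum_single [DecidableEq ι] (Ω : (Fin 2 → ι) → ℝ) :
    Ω = ∑ i, ∑ j, Ω ![i, j] • (Pi.single ![i, j] (1 : ℝ) : (Fin 2 → ι) → ℝ) := by
  funext I
  simp only [Finset.sum_apply, Pi.smul_apply, smul_eq_mul]
  have hI : I = ![I 0, I 1] := by
    funext k; fin_cases k <;> rfl
  rw [Finset.sum_eq_single (I 0), Finset.sum_eq_single (I 1)]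
  · rw [← hI, Pi.single_eq_same, mul_one]
  · intro j _ hj
    rw [Pi.single_eq_of_ne (fun h ↦ hj (by rw [hI, h]; rfl)), mul_zero]
  · simp
  · intro i _ hi
    refine Finset.sum_eq_zero fun j _ ↦ ?_
    rw [Pi.single_eq_of_ne (fun h ↦ hi (by rw [hI, h]; rfl)), mul_zero]
  · simp

/-! ### The symbol matrix -/

section Symbol

variable {P : Type*} [NormedAddCommGroup P] [NormedSpace ℝ P]

/-- **The (symmetrised) symbol matrix** of `F` at the jet point `x = (y, θ, J)`:
`a_{ij} = ½(DF(x)[δr_{ij}] + DF(x)[δr_{ji}])`, the derivative in the top slot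
(Gilbarg–Trudinger's `F_{ij} = ∂F/∂r_{ij}`). [cite: GilbargTrudinger2001, §17.4, (17.43)] -/
def symbolMatrix (F : EuclideanSpace ℝ ι × P × CJet ι 2 → ℝ) (x : EuclideanSpace ℝ ι × P × CJet ι 2) :
    Matrix ι ι ℝ :=
  Matrix.of fun i j ↦
    (fderiv ℝ F x ((0 : EuclideanSpace ℝ ι), (0 : P), topJet (Pi.single ![i, j] (1 : ℝ))) +
      fderiv ℝ F x ((0 : EuclideanSpace ℝ ι), (0 : P), topJet (Pi.single ![j, i] (1 : ℝ)))) / 2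

omit [Fintype ι] in
/-- Unfolding lemma. [folklore] -/
theorem symbolMatrix_apply (F : EuclideanSpace ℝ ι × P × CJet ι 2 → ℝ)
    (x : EuclideanSpace ℝ ι × P × CJet ι 2) (i j : ι) :
    symbolMatrix F x i j =
      (fderiv ℝ F x ((0 : EuclideanSpace ℝ ι), (0 : P), topJet (Pi.single ![i, j] (1 : ℝ))) +
        fderiv ℝ F x ((0 : EuclideanSpace ℝ ι), (0 : P), topJet (Pi.single ![j, i] (1 : ℝ)))) / 2 :=
  rfl

omit [Fintype ι] in
/-- The symbol matrix is symmetric. [folklore] -/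
theorem symbolMatrix_isSymm (F : EuclideanSpace ℝ ι × P × CJet ι 2 → ℝ)
    (x : EuclideanSpace ℝ ι × P × CJet ι 2) : (symbolMatrix F x).IsSymm := by
  ext i j
  simp only [transpose_apply, symbolMatrix_apply]
  ring

/-- The derivative in a top-slot direction is linear in the entries:
`DF(x)[(0,0,topJet Ω)] = Σ_{i,j} Ω(i,j) DF(x)[(0,0,topJet δ_{(i,j)})]`. [folklore] -/
theorem fderiv_topJet_eq_sum (F : EuclideanSpace ℝ ι × P × CJet ι 2 → ℝ)
    (x : EuclideanSpace ℝ ι × P × CJet ι 2) (Ω : (Fin 2 → ι) → ℝ) :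
    fderiv ℝ F x ((0 : EuclideanSpace ℝ ι), (0 : P), topJet Ω) =
      ∑ i, ∑ j, Ω ![i, j] *
        fderiv ℝ F x ((0 : EuclideanSpace ℝ ι), (0 : P), topJet (Pi.single ![i, j] (1 : ℝ))) := by
  set L := fderiv ℝ F x with hL
  have hv : ((0 : EuclideanSpace ℝ ι), (0 : P), topJet Ω) =
      ∑ i, ∑ j, Ω ![i, j] •
        (((0 : EuclideanSpace ℝ ι), (0 : P), topJet (Pi.single ![i, j] (1 : ℝ))) :
          EuclideanSpace ℝ ι × P × CJet ι 2) := by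
    conv_lhs => rw [eq_sum_sum_single Ω]
    rw [topJet_sum]
    simp_rw [topJet_sum, topJet_smul]
    ext <;> simp [Prod.fst_sum, Prod.snd_sum]
  rw [hv, map_sum]
  refine Finset.sum_congr rfl fun i _ ↦ ?_
  rw [map_sum]
  refine Finset.sum_congr rfl fun j _ ↦ ?_
  rw [map_smul, smul_eq_mul]

/-- **Pairing form of the top-slot derivative**: for a SYMMETRIC array `Ω`,
`DF(x)[(0, 0, topJet Ω)] = a : Ω` with `a = symbolMatrix F x`. [folklore] -/
theorem fderiv_topJet_eq_pair (F : EuclideanSpace ℝ ι × P × CJet ι 2 → ℝ)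
    (x : EuclideanSpace ℝ ι × P × CJet ι 2) {Ω : (Fin 2 → ι) → ℝ}
    (hΩ : ∀ i j, Ω ![i, j] = Ω ![j, i]) :
    fderiv ℝ F x ((0 : EuclideanSpace ℝ ι), (0 : P), topJet Ω) =
      pair (symbolMatrix F x) (Matrix.of fun i j ↦ Ω ![i, j]) := by
  rw [fderiv_topJet_eq_sum]
  simp only [pair, symbolMatrix_apply, Matrix.of_apply]
  -- `Σ Ω_ij ∂_ij = ½ Σ Ω_ij ∂_ij + ½ Σ Ω_ji ∂_ji` after swapping the summation in one copy
  have hswap : ∑ i, ∑ j, Ω ![i, j] *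
      fderiv ℝ F x ((0 : EuclideanSpace ℝ ι), (0 : P), topJet (Pi.single ![i, j] (1 : ℝ))) =
      ∑ i, ∑ j, Ω ![i, j] *
        fderiv ℝ F x ((0 : EuclideanSpace ℝ ι), (0 : P), topJet (Pi.single ![j, i] (1 : ℝ))) := by
    rw [Finset.sum_comm]
    exact Finset.sum_congr rfl fun i _ ↦ Finset.sum_congr rfl fun j _ ↦ by rw [hΩ j i]
  set S := ∑ i, ∑ j, Ω ![i, j] *
      fderiv ℝ F x ((0 : EuclideanSpace ℝ ι), (0 : P), topJet (Pi.single ![i, j] (1 : ℝ))) with hS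
  set S' := ∑ i, ∑ j, Ω ![i, j] *
      fderiv ℝ F x ((0 : EuclideanSpace ℝ ι), (0 : P), topJet (Pi.single ![j, i] (1 : ℝ))) with hS'
  have h2 : ∑ i, ∑ j, (fderiv ℝ F x ((0 : EuclideanSpace ℝ ι), (0 : P),
      topJet (Pi.single ![i, j] (1 : ℝ))) +
        fderiv ℝ F x ((0 : EuclideanSpace ℝ ι), (0 : P), topJet (Pi.single ![j, i] (1 : ℝ)))) / 2 *
          Ω ![i, j] = (S + S') / 2 := by
    rw [hS, hS', ← Finset.sum_add_distrib, Finset.sum_div]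
    refine Finset.sum_congr rfl fun i _ ↦ ?_
    rw [← Finset.sum_add_distrib, Finset.sum_div]
    exact Finset.sum_congr rfl fun j _ ↦ by ring
  rw [h2, ← hswap]
  ring

/-- **The quadratic form of the symbol matrix is the rank-one top-slot derivative**:
`ξᵀ a ξ = DF(x)[(0, 0, topJet (ξ ⊗ ξ))]`. So Gilbarg–Trudinger's (17.43) for `F` is exactly the
ellipticity of `symbolMatrix F` as used by `KrylovSafonov.weakHarnack`.
[cite: GilbargTrudinger2001, §17.4, (17.43)] -/
theorem dotProduct_symbolMatrix_mulVec (F : EuclideanSpace ℝ ι × P × CJet ι 2 → ℝ)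
    (x : EuclideanSpace ℝ ι × P × CJet ι 2) (ξ : ι → ℝ) :
    ξ ⬝ᵥ (symbolMatrix F x *ᵥ ξ) =
      fderiv ℝ F x ((0 : EuclideanSpace ℝ ι), (0 : P), topJet (fun I ↦ ξ (I 0) * ξ (I 1))) := by
  rw [fderiv_topJet_eq_pair F x (Ω := fun I ↦ ξ (I 0) * ξ (I 1)) (fun i j ↦ by simp [mul_comm]),
    ← pair_vecMulVec]
  rfl

end Symbol

/-! ### Pure second derivatives and the size of the third derivatives -/

/-- **The pure second derivative along a coordinate vector**:
`quadHess u γ y = γᵀ H γ`, `H = hessianMatrix u e y` the Hessian matrix in the standard basis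
(`= D²u(y)(γ̂, γ̂)`, `γ̂ = Σ γ_i e_i`). [cite: GilbargTrudinger2001, §17.4 (the functions `w_k`)] -/
def quadHess (u : EuclideanSpace ℝ ι → ℝ) (γ : ι → ℝ) (y : EuclideanSpace ℝ ι) : ℝ :=
  γ ⬝ᵥ (hessianMatrix u (EuclideanSpace.basisFun ι ℝ) y *ᵥ γ)

omit [DecidableEq ι] in
/-- Unfolding lemma. [folklore] -/
theorem quadHess_eq (u : EuclideanSpace ℝ ι → ℝ) (γ : ι → ℝ) (y : EuclideanSpace ℝ ι) :
    quadHess u γ y = γ ⬝ᵥ (hessianMatrix u (EuclideanSpace.basisFun ι ℝ) y *ᵥ γ) := rfl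

/-- **The squared size of the third derivatives** in the standard basis:
`thirdSq u y = Σ_{I : Fin 3 → ι} (D³u(y)(e_{I₀}, e_{I₁}, e_{I₂}))²`.
[cite: GilbargTrudinger2001, §17.4, (17.46)–(17.47) (`|D³u|²`)] -/
def thirdSq (u : EuclideanSpace ℝ ι → ℝ) (y : EuclideanSpace ℝ ι) : ℝ :=
  ∑ I : Fin 3 → ι, (iteratedFDeriv ℝ 3 u y (fun k ↦ EuclideanSpace.basisFun ι ℝ (I k))) ^ 2

omit [DecidableEq ι] in
/-- Unfolding lemma. [folklore] -/
theorem thirdSq_eq (u : EuclideanSpace ℝ ι → ℝ) (y : EuclideanSpace ℝ ι) :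
    thirdSq u y =
      ∑ I : Fin 3 → ι, (iteratedFDeriv ℝ 3 u y (fun k ↦ EuclideanSpace.basisFun ι ℝ (I k))) ^ 2 :=
  rfl

omit [DecidableEq ι] in
/-- `thirdSq u y ≥ 0`. [folklore] -/
theorem thirdSq_nonneg (u : EuclideanSpace ℝ ι → ℝ) (y : EuclideanSpace ℝ ι) : 0 ≤ thirdSq u y :=
  Finset.sum_nonneg fun _ _ ↦ sq_nonneg _

/-- **The Hessian matrix is the top slot of the coordinate `2`-jet**:
`hessianMatrix u e y i j = (cjet₂ u (y))₂ (i, j)`. [folklore] -/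
theorem hessianMatrix_eq_cjetOf (u : EuclideanSpace ℝ ι → ℝ) (y : EuclideanSpace ℝ ι) (i j : ι) :
    hessianMatrix u (EuclideanSpace.basisFun ι ℝ) y i j =
      cjetOf (EuclideanSpace.basisFun ι ℝ) 2 u y (Fin.last 2) ![i, j] := by
  rw [hessianMatrix_apply, cjetOf_apply]
  show _ = iteratedFDeriv ℝ 2 u y (fun k ↦ EuclideanSpace.basisFun ι ℝ (![i, j] k))
  rw [iteratedFDeriv_two_apply]
  simp

end Literature.Analysis.PDE.EvansKrylov

end
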